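import Summits.ResolutionOfSingularities.ResolutionOfSingularities.Theorems.FrobeniusLadderFInjectiveMacaulayficationCIJacobian
import Summits.ResolutionOfSingularities.ResolutionOfSingularities.Theorems.FrobeniusLadderFInjectiveMacaulayficationToricChartFedder
import HarnessLib

/-!
# (G4ᶜⁱ-reg, chart form) The smooth-chart certificate of the CI-CN engine: regularity and the clause at every point
# of a chart from face-wise Jacobian certificates of the RESTRICTED equations `g_l(y_S = 0)`

Support file for crux stmt-ResolutionOfSingularities-15315 (`FrobeniusLadder.FInjectiveMacaulayfication`), chain w45a, seat
res-L1-w45a-stub-6 (res-D-pv-018, D→L convert), file 8 of the CI-CN engine (idea-1 card 4; the chart half of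
`Sketch-L1-idea-1.lean` r4 §9 (G4ᶜⁱ-reg) `ciSmoothChartRegular` WITHOUT the torus transport: the certificate is asked directly
for the chart equations restricted to the coordinate strata). [OURS · L1 W4.5a] — NOT a statement of the manuscript
[claim: Hironaka2017]; AI-written, weaker than expert review.

On a chart `Spec k[y₀, …, y_{n-1}]` with strict transforms `g₁, …, g_r`, a prime `Q` of `k[y]/(g)` lies on exactly one
coordinate stratum: `S(Q) = {i : yᵢ ∈ Q}`. Modulo `(yᵢ : i ∈ S)` the equations become `g_l^S := g_l(y_S = 0)` and, for
`j ∉ S`, `∂/∂yⱼ` commutes with `y_S ↦ 0`; hence an `r×r` coordinate minor of `(∂g_l/∂yⱼ)` is congruent to the same minor of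
`(∂g_l^S/∂yⱼ)` modulo `(y_S) ⊆ Q ∩ k[y]`. So a SMOOTH-FACE CERTIFICATE for the stratum — a monomial `y^e` supported off `S` with
`y^e ∈ (g₁^S, …, g_r^S) + (the minors of the g^S)` (Nullstellensatz form of «V(g^S) is smooth of codimension r on the torus of
the stratum, or empty») — puts a minor of `g` outside `Q ∩ k[y]`, and `CIJacobian.ci_clause_of_det_not_mem` (Matsumura 30.4 (ii)
+ 14.2) gives: `(k[y]/(g))_Q` is regular, a domain, satisfies the per-stalk clause of the crux, and has the expected dimension.

* §1 `mk_span_X_substZero`, `sub_substZero_mem` (`q − q(y_S=0) ∈ (y_S)`), `pderiv_substZero` (`∂ⱼ` commutes with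
  `y_S ↦ 0` for `j ∉ S`), `det_pderiv_substZero`.
* §2 `ci_clause_of_smoothFaceCertificate` (one stratum `S = S(Q)`), `ci_clause_of_smoothFaceCertificates` (all strata at once:
  the form a SMOOTH chart of a CI-CN calibration — T₁₁⁺ / T⁽⁴⁾⁺, K-T4 — supplies as decidable data, one monomial membership per
  stratum).

No definitions, no named facts; glue. [folklore; cite: Matsumura1987, Thm. 30.4 (ii) and Thm. 14.2]
-/

-- single-problem summit: the doubled namespace component is forced
set_option linter.dupNamespace false

noncomputable section

namespace Summit.ResolutionOfSingularities.ResolutionOfSingularities.Theorems.FInjectiveMacaulayfication.CISmoothChart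

open MvPolynomial
open Summit.ResolutionOfSingularities.ResolutionOfSingularities.Theorems.FInjectiveMacaulayfication

variable {k : Type} [CommRing k] {n : ℕ}

/-! ## §1 Setting the stratum coordinates to zero -/

/-- Modulo `(yᵢ : i ∈ S)`, a polynomial agrees with its restriction `q(y_S = 0)`. [folklore] -/
theorem mk_span_X_substZero (S : Finset (Fin n)) (q : MvPolynomial (Fin n) k) :
    Ideal.Quotient.mk (Ideal.span ((fun i : Fin n => (X i : MvPolynomial (Fin n) k)) '' (S : Set (Fin n))))
        (aeval (fun i : Fin n => if i ∈ S then (0 : MvPolynomial (Fin n) k) else X i) q) =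
      Ideal.Quotient.mk (Ideal.span ((fun i : Fin n => (X i : MvPolynomial (Fin n) k)) '' (S : Set (Fin n)))) q := by
  set I : Ideal (MvPolynomial (Fin n) k) :=
    Ideal.span ((fun i : Fin n => (X i : MvPolynomial (Fin n) k)) '' (S : Set (Fin n))) with hI
  have h : (Ideal.Quotient.mkₐ k I).comp
      (aeval (fun i : Fin n => if i ∈ S then (0 : MvPolynomial (Fin n) k) else X i)) = Ideal.Quotient.mkₐ k I := by
    refine algHom_ext fun i => ?_
    rw [AlgHom.comp_apply, aeval_X, Ideal.Quotient.mkₐ_eq_mk]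
    split_ifs with hi
    · rw [map_zero, eq_comm, Ideal.Quotient.eq_zero_iff_mem]
      exact Ideal.subset_span ⟨i, hi, rfl⟩
    · rfl
  have h' := DFunLike.congr_fun h q
  rw [AlgHom.comp_apply, Ideal.Quotient.mkₐ_eq_mk] at h'
  exact h'

/-- `q − q(y_S = 0) ∈ (yᵢ : i ∈ S)`. [folklore] -/
theorem sub_substZero_mem (S : Finset (Fin n)) (q : MvPolynomial (Fin n) k) :
    q - aeval (fun i : Fin n => if i ∈ S then (0 : MvPolynomial (Fin n) k) else X i) q ∈
      Ideal.span ((fun i : Fin n => (X i : MvPolynomial (Fin n) k)) '' (S : Set (Fin n))) := by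
  rw [← Ideal.Quotient.eq, mk_span_X_substZero]

/-- For `j ∉ S`, `∂/∂yⱼ` commutes with `y_S ↦ 0`. [folklore] -/
theorem pderiv_substZero (S : Finset (Fin n)) {j : Fin n} (hj : j ∉ S) (q : MvPolynomial (Fin n) k) :
    pderiv j (aeval (fun i : Fin n => if i ∈ S then (0 : MvPolynomial (Fin n) k) else X i) q) =
      aeval (fun i : Fin n => if i ∈ S then (0 : MvPolynomial (Fin n) k) else X i) (pderiv j q) := by
  classical
  induction q using MvPolynomial.induction_on' with
  | monomial e c =>
    rw [ToricChartFedder.substZero_monomial, pderiv_monomial, ToricChartFedder.substZero_monomial]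
    have hiff : (∀ i ∈ S, e i = 0) ↔ ∀ i ∈ S, (e - Finsupp.single j 1 : Fin n →₀ ℕ) i = 0 := by
      refine forall₂_congr fun i hi => ?_
      have hij : i ≠ j := fun h => hj (h ▸ hi)
      rw [Finsupp.tsub_apply, Finsupp.single_apply, if_neg hij.symm, tsub_zero]
    by_cases h : ∀ i ∈ S, e i = 0
    · rw [if_pos h, if_pos (hiff.mp h), pderiv_monomial]
    · rw [if_neg h, if_neg (fun h' => h (hiff.mpr h')), map_zero]
  | add f g hf hg => rw [map_add, map_add, hf, hg, map_add, map_add]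

/-- A coordinate minor of the restricted equations is the restriction of the same minor (columns off `S`). [folklore] -/
theorem det_pderiv_substZero (S : Finset (Fin n)) {r : ℕ} (js : Fin r → Fin n) (hjs : ∀ i, js i ∉ S)
    (g : Fin r → MvPolynomial (Fin n) k) :
    (Matrix.of fun i l => pderiv (js i)
        (aeval (fun i : Fin n => if i ∈ S then (0 : MvPolynomial (Fin n) k) else X i) (g l))).det =
      aeval (fun i : Fin n => if i ∈ S then (0 : MvPolynomial (Fin n) k) else X i)
        (Matrix.of fun i l => pderiv (js i) (g l)).det := by
  rw [AlgHom.map_det]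
  congr 1
  ext i l
  simp only [Matrix.of_apply, AlgHom.mapMatrix_apply, Matrix.map_apply]
  rw [pderiv_substZero S (hjs i)]

/-! ## §2 The smooth-face certificate -/

/-- **THE CLAUSE ON A STRATUM FROM A SMOOTH-FACE CERTIFICATE.** `k` a field of characteristic `p`, `g₁, …, g_r ∈ k[y₀, …, y_{n-1}]`,
`Q` a prime of `k[y]/(g)` on the stratum `S` (`i ∈ S ↔ ȳᵢ ∈ Q`). If some monomial `y^e` supported off `S` lies in
`(g₁^S, …, g_r^S) + (det(∂ g_l^S / ∂ y_{js μ i}))_μ` (`g^S = g(y_S = 0)`; finitely many `r×r` coordinate minors), then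
`(k[y]/(g))_Q` is a regular local ring, a domain, satisfies the per-stalk clause of `FrobeniusLadder.FInjectiveMacaulayfication`,
and `dim (k[y]/(g))_Q + r = dim k[y]_{Q ∩ k[y]}`. [cite: Matsumura1987, Thm. 30.4 (ii) and Thm. 14.2] -/
theorem ci_clause_of_smoothFaceCertificate (p : ℕ) [Fact p.Prime] (K : Type) [Field K] [CharP K p] (n r : ℕ)
    (g : Fin r → MvPolynomial (Fin n) K)
    (Q : Ideal (MvPolynomial (Fin n) K ⧸ Ideal.span (Set.range g))) [Q.IsPrime]
    (S : Finset (Fin n)) (hS : ∀ i : Fin n, i ∈ S ↔ Ideal.Quotient.mk (Ideal.span (Set.range g)) (X i) ∈ Q)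
    (t : ℕ) (js : Fin t → Fin r → Fin n) (e : Fin n →₀ ℕ) (he : ∀ i ∈ S, e i = 0)
    (hcert : (monomial e (1 : K) : MvPolynomial (Fin n) K) ∈
      Ideal.span (Set.range fun l : Fin r =>
          aeval (fun i : Fin n => if i ∈ S then (0 : MvPolynomial (Fin n) K) else X i) (g l)) ⊔
        Ideal.span (Set.range fun μ : Fin t => (Matrix.of fun i l => pderiv (js μ i)
          (aeval (fun i : Fin n => if i ∈ S then (0 : MvPolynomial (Fin n) K) else X i) (g l))).det)) :
    IsRegularLocalRing (Localization.AtPrime Q) ∧ IsDomain (Localization.AtPrime Q) ∧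
      (∀ d : ℕ, ringKrullDim (Localization.AtPrime Q) = d → ∀ s : Fin d → Localization.AtPrime Q,
        (Ideal.span (Set.range s)).radical.IsMaximal →
          RingTheory.Sequence.IsWeaklyRegular (Localization.AtPrime Q) (List.ofFn s) ∧
          ∀ y : Localization.AtPrime Q, (∃ e : ℕ, y ^ p ^ e ∈ Ideal.span
            ((fun z : Localization.AtPrime Q => z ^ p ^ e) ''
              (Ideal.span (Set.range s) : Set (Localization.AtPrime Q)))) → y ∈ Ideal.span (Set.range s)) ∧
      ringKrullDim (Localization.AtPrime Q) + r =
        ringKrullDim (Localization.AtPrime (Q.comap (Ideal.Quotient.mk (Ideal.span (Set.range g))))) := by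
  classical
  set P : Ideal (MvPolynomial (Fin n) K) := Q.comap (Ideal.Quotient.mk (Ideal.span (Set.range g))) with hP_def
  haveI hPprime : P.IsPrime := Ideal.comap_isPrime _ Q
  -- the stratum ideal `(y_S)` lies in `P`; `y^e ∉ P`
  have hSP : Ideal.span ((fun i : Fin n => (X i : MvPolynomial (Fin n) K)) '' (S : Set (Fin n))) ≤ P := by
    refine Ideal.span_le.mpr ?_
    rintro _ ⟨i, hi, rfl⟩
    rw [SetLike.mem_coe, hP_def, Ideal.mem_comap]
    exact (hS i).mp (Finset.mem_coe.mp hi)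
  have hmonP : (monomial e (1 : K) : MvPolynomial (Fin n) K) ∉ P := by
    intro hmem
    rw [monomial_eq, C_1, one_mul, Finsupp.prod] at hmem
    obtain ⟨i, hi, hXi⟩ := Ideal.IsPrime.prod_mem_iff.mp hmem
    have hXP : (X i : MvPolynomial (Fin n) K) ∈ P := hPprime.mem_of_pow_mem _ hXi
    have hiS : i ∈ S := (hS i).mpr (by rw [hP_def, Ideal.mem_comap] at hXP; exact hXP)
    have := he i hiS
    rw [Finsupp.mem_support_iff] at hi
    exact hi this
  -- the restricted equations lie in `P`
  have hgSP : ∀ l, aeval (fun i : Fin n => if i ∈ S then (0 : MvPolynomial (Fin n) K) else X i) (g l) ∈ P := by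
    intro l
    have hgl : g l ∈ P := by
      rw [hP_def, Ideal.mem_comap, Ideal.Quotient.eq_zero_iff_mem.mpr (Ideal.subset_span (Set.mem_range_self l))]
      exact Q.zero_mem
    have h := P.sub_mem hgl (hSP (sub_substZero_mem S (g l)))
    rwa [sub_sub_cancel] at h
  -- some restricted minor lies outside `P`
  have hex : ∃ μ : Fin t, (Matrix.of fun i l => pderiv (js μ i)
      (aeval (fun i : Fin n => if i ∈ S then (0 : MvPolynomial (Fin n) K) else X i) (g l))).det ∉ P := by
    by_contra hall
    have hall' : ∀ μ : Fin t, (Matrix.of fun i l => pderiv (js μ i)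
        (aeval (fun i : Fin n => if i ∈ S then (0 : MvPolynomial (Fin n) K) else X i) (g l))).det ∈ P :=
      fun μ => not_not.mp (not_exists.mp hall μ)
    have hle : Ideal.span (Set.range fun l : Fin r =>
          aeval (fun i : Fin n => if i ∈ S then (0 : MvPolynomial (Fin n) K) else X i) (g l)) ⊔
        Ideal.span (Set.range fun μ : Fin t => (Matrix.of fun i l => pderiv (js μ i)
          (aeval (fun i : Fin n => if i ∈ S then (0 : MvPolynomial (Fin n) K) else X i) (g l))).det) ≤ P := by
      refine sup_le (Ideal.span_le.mpr ?_) (Ideal.span_le.mpr ?_)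
      · rintro _ ⟨l, rfl⟩; exact hgSP l
      · rintro _ ⟨μ, rfl⟩; exact hall' μ
    exact hmonP (hle hcert)
  obtain ⟨μ, hμ⟩ := hex
  -- its columns are off `S` (a column in `S` kills the row: `∂ⱼ (q(y_S=0)) = 0` for `j ∈ S`)
  have hjs : ∀ i, js μ i ∉ S := by
    intro i hi
    apply hμ
    have hrow : ∀ l, pderiv (js μ i)
        (aeval (fun i : Fin n => if i ∈ S then (0 : MvPolynomial (Fin n) K) else X i) (g l)) = 0 := by
      intro l
      -- `q(y_S = 0)` does not involve `y_j`, `j ∈ S`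
      induction (g l) using MvPolynomial.induction_on' with
      | monomial e' c =>
        rw [ToricChartFedder.substZero_monomial]
        by_cases h : ∀ i ∈ S, e' i = 0
        · rw [if_pos h, pderiv_monomial, h _ hi, Nat.cast_zero, mul_zero, monomial_zero]
        · rw [if_neg h, map_zero]
      | add f₁ f₂ hf₁ hf₂ => rw [map_add, map_add, hf₁, hf₂, add_zero]
    have hdet : (Matrix.of fun i l => pderiv (js μ i)
        (aeval (fun i : Fin n => if i ∈ S then (0 : MvPolynomial (Fin n) K) else X i) (g l))).det = 0 := by
      refine Matrix.det_eq_zero_of_row_eq_zero i fun l => ?_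
      rw [Matrix.of_apply, hrow l]
    rw [hdet]
    exact P.zero_mem
  -- the same minor of `g` itself is outside `P`
  have hminor : (Matrix.of fun i l => pderiv (js μ i) (g l)).det ∉ P := by
    intro hmem
    apply hμ
    rw [det_pderiv_substZero S (js μ) hjs g]
    have h := P.sub_mem hmem (hSP (sub_substZero_mem S ((Matrix.of fun i l => pderiv (js μ i) (g l)).det)))
    rwa [sub_sub_cancel] at h
  exact CIJacobian.ci_clause_of_det_not_mem p K n r g Q (fun i => (pderiv (js μ i)).restrictScalars ℤ)
    (by simpa only [Derivation.restrictScalars_apply] using hminor)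

/-- **THE CLAUSE ON A WHOLE SMOOTH CHART FROM FACE CERTIFICATES** (the one-call form a smooth chart of a CI-CN calibration
consumes): if for EVERY coordinate stratum `S` a smooth-face certificate is supplied (a monomial off `S` in
`(g^S) + (coordinate minors of g^S)` — for an EMPTY stratum the minors may be omitted, `t = 0`), then at every prime `Q` of
`k[y]/(g)` the local ring is regular, a domain, satisfies the per-stalk clause of the crux, and `dim + r = dim k[y]_{Q ∩ k[y]}`
(`= n` at closed points). [cite: Matsumura1987, Thm. 30.4 (ii) and Thm. 14.2] -/
theorem ci_clause_of_smoothFaceCertificates : ∀ (p : ℕ) [Fact p.Prime] (K : Type) [Field K] [CharP K p] (n r : ℕ)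
    (g : Fin r → MvPolynomial (Fin n) K),
    (∀ S : Finset (Fin n), ∃ (t : ℕ) (js : Fin t → Fin r → Fin n) (e : Fin n →₀ ℕ), (∀ i ∈ S, e i = 0) ∧
      (monomial e (1 : K) : MvPolynomial (Fin n) K) ∈
        Ideal.span (Set.range fun l : Fin r =>
            aeval (fun i : Fin n => if i ∈ S then (0 : MvPolynomial (Fin n) K) else X i) (g l)) ⊔
          Ideal.span (Set.range fun μ : Fin t => (Matrix.of fun i l => pderiv (js μ i)
            (aeval (fun i : Fin n => if i ∈ S then (0 : MvPolynomial (Fin n) K) else X i) (g l))).det)) →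
    ∀ (Q : Ideal (MvPolynomial (Fin n) K ⧸ Ideal.span (Set.range g))) [Q.IsPrime],
    IsRegularLocalRing (Localization.AtPrime Q) ∧ IsDomain (Localization.AtPrime Q) ∧
      (∀ d : ℕ, ringKrullDim (Localization.AtPrime Q) = d → ∀ s : Fin d → Localization.AtPrime Q,
        (Ideal.span (Set.range s)).radical.IsMaximal →
          RingTheory.Sequence.IsWeaklyRegular (Localization.AtPrime Q) (List.ofFn s) ∧
          ∀ y : Localization.AtPrime Q, (∃ e : ℕ, y ^ p ^ e ∈ Ideal.span
            ((fun z : Localization.AtPrime Q => z ^ p ^ e) ''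
              (Ideal.span (Set.range s) : Set (Localization.AtPrime Q)))) → y ∈ Ideal.span (Set.range s)) ∧
      ringKrullDim (Localization.AtPrime Q) + r =
        ringKrullDim (Localization.AtPrime (Q.comap (Ideal.Quotient.mk (Ideal.span (Set.range g))))) := by
  intro p _ K _ _ n r g hcert Q _
  classical
  set S : Finset (Fin n) := Finset.univ.filter fun i => Ideal.Quotient.mk (Ideal.span (Set.range g)) (X i) ∈ Q
    with hS_def
  have hS : ∀ i : Fin n, i ∈ S ↔ Ideal.Quotient.mk (Ideal.span (Set.range g)) (X i) ∈ Q := fun i => by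
    rw [hS_def, Finset.mem_filter]
    exact ⟨fun h => h.2, fun h => ⟨Finset.mem_univ i, h⟩⟩
  obtain ⟨t, js, e, he, hmem⟩ := hcert S
  exact ci_clause_of_smoothFaceCertificate p K n r g Q S hS t js e he hmem

end Summit.ResolutionOfSingularities.ResolutionOfSingularities.Theorems.FInjectiveMacaulayfication.CISmoothChart

end
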